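import Mathlib
import Summits.KontsevichZagierPeriods.KontsevichZagierPeriods.Theorems.BetaCancellation.Negative.Torsion
import Literature.NumberTheory.Transcendental.KZFibredRelations

/-!
# `BetaCancellation` (stmt-13633), line `dirichlet-companion-to-pi` — Archimedes' trisection, I: the rotated segments

ARCHIMEDES' TRISECTION of the unit disc `D = {x² + y² ≤ 1}` inside the Kontsevich–Zagier calculus,
first half. Let `S_A = D ∩ {x < -1/2}` be the circular segment cut off by the chord `x = -1/2`
(a SLAB piece of the disc in its first coordinate: `KZ.piRep.slabRestrict (-2) (-1/2)`), and
`S_B`, `S_C` its images under the rotations `ρ`, `σ` by `∓2π/3` (matrices with the real-algebraic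
entries `-1/2, ±√3/2`, determinant `1`). This file proves that the two rotations are
`ℚ`-semialgebraic changes of variables (rule (2)), so `[S_A] ∼ [S_B]` and `[S_A] ∼ [S_C]`
(`stub_segmentRotations`, registered on the crux), and describes `S_B`, `S_C` in coordinates: the
parts of the disc beyond the chords `x + √3 y = 1`, `x − √3 y = 1`. The rotations enter as
variables `ρ`, `σ` pinned by their defining equations (no definitions, no notation). The second
half (`…StubArchimedesTriangle.lean`) adds the inscribed equilateral triangle and proves the
registered stub `stub_archimedesOfTriangle` of the crux skeleton (seat c7): slab pieces of a
fibred certificate cancel separately, hence so does the triangle, an algebraic constant.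
-/

noncomputable section

-- `Summit.KontsevichZagierPeriods.KontsevichZagierPeriods.…` is the tree's mandated layout (single-conjunct summit).
set_option linter.dupNamespace false

namespace Summit.KontsevichZagierPeriods.KontsevichZagierPeriods.BetaCancellationLine

open Set MeasureTheory
open Literature.NumberTheory.Transcendental
open Literature.NumberTheory.Transcendental.KZ

/-! ## Algebraic constants -/

/-- `√3` is integral over `ℚ` (root of the monic `X² − 3`). [folklore] -/
theorem isIntegral_sqrt_three : IsIntegral ℚ (Real.sqrt 3) := by
  refine ⟨Polynomial.X ^ 2 - Polynomial.C (3 : ℚ), Polynomial.monic_X_pow_sub_C _ two_ne_zero, ?_⟩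
  have h3 : Real.sqrt 3 ^ 2 = 3 := Real.sq_sqrt (by norm_num)
  simp only [Polynomial.eval₂_sub, Polynomial.eval₂_X_pow, Polynomial.eval₂_C, h3]
  simp

/-- `√3/2` is algebraic over `ℚ`. [folklore] -/
theorem isAlgebraic_sqrt_three_div_two : IsAlgebraic ℚ (Real.sqrt 3 / 2) := by
  have h := isIntegral_sqrt_three.isAlgebraic.mul (isAlgebraic_algebraMap (R := ℚ) (A := ℝ) (1/2 : ℚ))
  have e : (Real.sqrt 3 / 2 : ℝ) = Real.sqrt 3 * ((1/2 : ℚ) : ℝ) := by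
    rw [Rat.cast_div, Rat.cast_one, Rat.cast_ofNat]; ring
  rw [e]; exact h

/-- `-1/2` is algebraic over `ℚ`. [folklore] -/
theorem isAlgebraic_neg_half : IsAlgebraic ℚ (-(1/2) : ℝ) := by
  have e : (-(1/2) : ℝ) = ((-(1/2) : ℚ) : ℝ) := by
    rw [Rat.cast_neg, Rat.cast_div, Rat.cast_one, Rat.cast_ofNat]
  rw [e]; exact isAlgebraic_algebraMap (R := ℚ) (A := ℝ) (-(1/2) : ℚ)

/-- `3√3/4` (the area of the inscribed equilateral triangle) is algebraic over `ℚ`. [folklore] -/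
theorem isAlgebraic_triangleArea : IsAlgebraic ℚ (3 * Real.sqrt 3 / 4) := by
  have h := isIntegral_sqrt_three.isAlgebraic.mul (isAlgebraic_algebraMap (R := ℚ) (A := ℝ) (3/4 : ℚ))
  have e : (3 * Real.sqrt 3 / 4 : ℝ) = Real.sqrt 3 * ((3/4 : ℚ) : ℝ) := by
    rw [Rat.cast_div, Rat.cast_ofNat, Rat.cast_ofNat]; ring
  rw [e]; exact h

/-- `3√3/4 ≠ 0`. [folklore] -/
theorem triangleArea_ne_zero : (3 * Real.sqrt 3 / 4 : ℝ) ≠ 0 := by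
  have : 0 < Real.sqrt 3 := Real.sqrt_pos.2 (by norm_num)
  positivity

/-- A linear form `a x + b y` with real-algebraic coefficients is a `ℚ`-semialgebraic function on
any `ℚ`-semialgebraic set. [folklore] -/
theorem isSemialgebraicFunOn_linearForm {s : Set (Fin 2 → ℝ)}
    (hs : Literature.ModelTheory.ExponentialFields.IsSemialgebraic ℚ s) {a b : ℝ}
    (ha : IsAlgebraic ℚ a) (hb : IsAlgebraic ℚ b) :
    IsSemialgebraicFunOn ℚ s (fun z => a * z 0 + b * z 1) := by
  have h0 : IsSemialgebraicFunOn ℚ s (fun z : Fin 2 → ℝ => z 0) :=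
    (isSemialgebraicFunOn_aeval hs (MvPolynomial.X 0)).congr fun z _ => by simp
  have h1 : IsSemialgebraicFunOn ℚ s (fun z : Fin 2 → ℝ => z 1) :=
    (isSemialgebraicFunOn_aeval hs (MvPolynomial.X 1)).congr fun z _ => by simp
  have hm0 := IsSemialgebraicFunOn.mul_holds (isSemialgebraicFunOn_const_of_isAlgebraic hs ha) h0
  have hm1 := IsSemialgebraicFunOn.mul_holds (isSemialgebraicFunOn_const_of_isAlgebraic hs hb) h1
  exact (IsSemialgebraicFunOn.add_holds hm0 hm1).congr fun z _ => rfl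

/-- Membership in the slab segment `S_A = D ∩ {-2 < x < -1/2}`. [folklore] -/
theorem mem_segA_domain (z : Fin 2 → ℝ) :
    z ∈ (piRep.slabRestrict (-2) (-1/2)).domain ↔ z 0 ^ 2 + z 1 ^ 2 ≤ 1 ∧ -2 < z 0 ∧ z 0 < -(1/2) := by
  simp only [IntegralRep.domain_slabRestrict, piRep_domain, mem_inter_iff, mem_piDisc, mem_paramSlab]
  norm_num

/-- Membership in the slab `D ∩ {-1/2 < x < 2}`. [folklore] -/
theorem mem_discR_domain (z : Fin 2 → ℝ) :
    z ∈ (piRep.slabRestrict (-1/2) 2).domain ↔ z 0 ^ 2 + z 1 ^ 2 ≤ 1 ∧ -(1/2) < z 0 ∧ z 0 < 2 := by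
  simp only [IntegralRep.domain_slabRestrict, piRep_domain, mem_inter_iff, mem_piDisc, mem_paramSlab]
  norm_num

/-- Cauchy–Schwarz for the form `x + √3 y` on the unit disc: `x + √3 y ≤ 2`. [folklore] -/
theorem form_le_two {z : Fin 2 → ℝ} (hd : z 0 ^ 2 + z 1 ^ 2 ≤ 1) : z 0 + Real.sqrt 3 * z 1 ≤ 2 := by
  have h3 : Real.sqrt 3 ^ 2 = 3 := Real.sq_sqrt (by norm_num)
  nlinarith [sq_nonneg (Real.sqrt 3 * z 0 - z 1), sq_nonneg (z 0 + Real.sqrt 3 * z 1 - 2),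
    sq_nonneg (z 0 + Real.sqrt 3 * z 1 + 2)]

/-- Cauchy–Schwarz for the form `x − √3 y` on the unit disc: `x − √3 y ≤ 2`. [folklore] -/
theorem form'_le_two {z : Fin 2 → ℝ} (hd : z 0 ^ 2 + z 1 ^ 2 ≤ 1) : z 0 - Real.sqrt 3 * z 1 ≤ 2 := by
  have h3 : Real.sqrt 3 ^ 2 = 3 := Real.sq_sqrt (by norm_num)
  nlinarith [sq_nonneg (Real.sqrt 3 * z 0 + z 1), sq_nonneg (z 0 - Real.sqrt 3 * z 1 - 2),
    sq_nonneg (z 0 - Real.sqrt 3 * z 1 + 2)]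

/-! ## The rotation `ρ` by `-2π/3` -/

section NegRot

variable {ρ : (Fin 2 → ℝ) →L[ℝ] (Fin 2 → ℝ)}
  (hρ : ρ = LinearMap.toContinuousLinearMap
    (Matrix.toLin' (!![-(1/2 : ℝ), Real.sqrt 3 / 2; -(Real.sqrt 3 / 2), -(1/2)] : Matrix (Fin 2) (Fin 2) ℝ)))

include hρ

/-- First coordinate of `ρ`. [folklore] -/
theorem rotNeg_apply_zero (z : Fin 2 → ℝ) : ρ z 0 = -(1/2) * z 0 + Real.sqrt 3 / 2 * z 1 := by
  subst hρ
  simp [Matrix.mulVec, dotProduct, Fin.sum_univ_two]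

/-- Second coordinate of `ρ`. [folklore] -/
theorem rotNeg_apply_one (z : Fin 2 → ℝ) : ρ z 1 = -(Real.sqrt 3 / 2) * z 0 + -(1/2) * z 1 := by
  subst hρ
  simp [Matrix.mulVec, dotProduct, Fin.sum_univ_two]

/-- `det ρ = 1`. [folklore] -/
theorem det_rotNeg : ρ.det = 1 := by
  subst hρ
  have h3 : Real.sqrt 3 ^ 2 = 3 := Real.sq_sqrt (by norm_num)
  simp only [ContinuousLinearMap.det, LinearMap.coe_toContinuousLinearMap, LinearMap.det_toLin',
    Matrix.det_fin_two_of]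
  nlinarith [h3]

/-- `ρ` preserves `x² + y²`. [folklore] -/
theorem normSq_rotNeg (z : Fin 2 → ℝ) : ρ z 0 ^ 2 + ρ z 1 ^ 2 = z 0 ^ 2 + z 1 ^ 2 := by
  have h3 : Real.sqrt 3 ^ 2 = 3 := Real.sq_sqrt (by norm_num)
  rw [rotNeg_apply_zero hρ, rotNeg_apply_one hρ]
  linear_combination (1/4 * (z 0 ^ 2 + z 1 ^ 2)) * h3

/-- The linear form `x + √3 y` after `ρ` is `-2x`. [folklore] -/
theorem form_rotNeg (z : Fin 2 → ℝ) : ρ z 0 + Real.sqrt 3 * ρ z 1 = -2 * z 0 := by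
  have h3 : Real.sqrt 3 ^ 2 = 3 := Real.sq_sqrt (by norm_num)
  rw [rotNeg_apply_zero hρ, rotNeg_apply_one hρ]
  linear_combination (-(1/2) * z 0) * h3

/-- `ρ` is a `ℚ`-semialgebraic map on any `ℚ`-semialgebraic set. [folklore] -/
theorem isSemialgebraicMapOn_rotNeg {s : Set (Fin 2 → ℝ)}
    (hs : Literature.ModelTheory.ExponentialFields.IsSemialgebraic ℚ s) :
    IsSemialgebraicMapOn ℚ s ρ := by
  refine IsSemialgebraicMapOn.of_forall hs fun j => ?_
  fin_cases j
  · exact (isSemialgebraicFunOn_linearForm hs isAlgebraic_neg_half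
      isAlgebraic_sqrt_three_div_two).congr fun z _ => by
      simp only [Fin.zero_eta, Fin.isValue, rotNeg_apply_zero hρ]
  · exact (isSemialgebraicFunOn_linearForm hs isAlgebraic_sqrt_three_div_two.neg
      isAlgebraic_neg_half).congr fun z _ => by
      simp only [Fin.mk_one, Fin.isValue, rotNeg_apply_one hρ]

end NegRot

/-! ## The rotation `σ` by `+2π/3` -/

section PosRot

variable {σ : (Fin 2 → ℝ) →L[ℝ] (Fin 2 → ℝ)}
  (hσ : σ = LinearMap.toContinuousLinearMap
    (Matrix.toLin' (!![-(1/2 : ℝ), -(Real.sqrt 3 / 2); Real.sqrt 3 / 2, -(1/2)] : Matrix (Fin 2) (Fin 2) ℝ)))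

include hσ

/-- First coordinate of `σ`. [folklore] -/
theorem rotPos_apply_zero (z : Fin 2 → ℝ) : σ z 0 = -(1/2) * z 0 + -(Real.sqrt 3 / 2) * z 1 := by
  subst hσ
  simp [Matrix.mulVec, dotProduct, Fin.sum_univ_two]

/-- Second coordinate of `σ`. [folklore] -/
theorem rotPos_apply_one (z : Fin 2 → ℝ) : σ z 1 = Real.sqrt 3 / 2 * z 0 + -(1/2) * z 1 := by
  subst hσ
  simp [Matrix.mulVec, dotProduct, Fin.sum_univ_two]

/-- `det σ = 1`. [folklore] -/
theorem det_rotPos : σ.det = 1 := by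
  subst hσ
  have h3 : Real.sqrt 3 ^ 2 = 3 := Real.sq_sqrt (by norm_num)
  simp only [ContinuousLinearMap.det, LinearMap.coe_toContinuousLinearMap, LinearMap.det_toLin',
    Matrix.det_fin_two_of]
  nlinarith [h3]

/-- `σ` preserves `x² + y²`. [folklore] -/
theorem normSq_rotPos (z : Fin 2 → ℝ) : σ z 0 ^ 2 + σ z 1 ^ 2 = z 0 ^ 2 + z 1 ^ 2 := by
  have h3 : Real.sqrt 3 ^ 2 = 3 := Real.sq_sqrt (by norm_num)
  rw [rotPos_apply_zero hσ, rotPos_apply_one hσ]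
  linear_combination (1/4 * (z 0 ^ 2 + z 1 ^ 2)) * h3

/-- The linear form `x − √3 y` after `σ` is `-2x`. [folklore] -/
theorem form_rotPos (z : Fin 2 → ℝ) : σ z 0 - Real.sqrt 3 * σ z 1 = -2 * z 0 := by
  have h3 : Real.sqrt 3 ^ 2 = 3 := Real.sq_sqrt (by norm_num)
  rw [rotPos_apply_zero hσ, rotPos_apply_one hσ]
  linear_combination (-(1/2) * z 0) * h3

/-- `σ` is a `ℚ`-semialgebraic map on any `ℚ`-semialgebraic set. [folklore] -/
theorem isSemialgebraicMapOn_rotPos {s : Set (Fin 2 → ℝ)}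
    (hs : Literature.ModelTheory.ExponentialFields.IsSemialgebraic ℚ s) :
    IsSemialgebraicMapOn ℚ s σ := by
  refine IsSemialgebraicMapOn.of_forall hs fun j => ?_
  fin_cases j
  · exact (isSemialgebraicFunOn_linearForm hs isAlgebraic_neg_half
      isAlgebraic_sqrt_three_div_two.neg).congr fun z _ => by
      simp only [Fin.zero_eta, Fin.isValue, rotPos_apply_zero hσ]
  · exact (isSemialgebraicFunOn_linearForm hs isAlgebraic_sqrt_three_div_two
      isAlgebraic_neg_half).congr fun z _ => by
      simp only [Fin.mk_one, Fin.isValue, rotPos_apply_one hσ]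

end PosRot

/-! ## The rotated segments `S_B = ρ(S_A)`, `S_C = σ(S_A)` -/

section BothRot

variable {ρ σ : (Fin 2 → ℝ) →L[ℝ] (Fin 2 → ℝ)}
  (hρ : ρ = LinearMap.toContinuousLinearMap
    (Matrix.toLin' (!![-(1/2 : ℝ), Real.sqrt 3 / 2; -(Real.sqrt 3 / 2), -(1/2)] : Matrix (Fin 2) (Fin 2) ℝ)))
  (hσ : σ = LinearMap.toContinuousLinearMap
    (Matrix.toLin' (!![-(1/2 : ℝ), -(Real.sqrt 3 / 2); Real.sqrt 3 / 2, -(1/2)] : Matrix (Fin 2) (Fin 2) ℝ)))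

include hρ hσ

/-- `σ ∘ ρ = id`. [folklore] -/
theorem rotPos_rotNeg (z : Fin 2 → ℝ) : σ (ρ z) = z := by
  have h3 : Real.sqrt 3 ^ 2 = 3 := Real.sq_sqrt (by norm_num)
  ext i
  fin_cases i
  · simp only [Fin.zero_eta, Fin.isValue, rotPos_apply_zero hσ, rotNeg_apply_zero hρ, rotNeg_apply_one hρ]
    linear_combination (1/4 * z 0) * h3
  · simp only [Fin.mk_one, Fin.isValue, rotPos_apply_one hσ, rotNeg_apply_zero hρ, rotNeg_apply_one hρ]
    linear_combination (1/4 * z 1) * h3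

/-- `ρ ∘ σ = id`. [folklore] -/
theorem rotNeg_rotPos (z : Fin 2 → ℝ) : ρ (σ z) = z := by
  have h3 : Real.sqrt 3 ^ 2 = 3 := Real.sq_sqrt (by norm_num)
  ext i
  fin_cases i
  · simp only [Fin.zero_eta, Fin.isValue, rotNeg_apply_zero hρ, rotPos_apply_zero hσ, rotPos_apply_one hσ]
    linear_combination (1/4 * z 0) * h3
  · simp only [Fin.mk_one, Fin.isValue, rotNeg_apply_one hρ, rotPos_apply_zero hσ, rotPos_apply_one hσ]
    linear_combination (1/4 * z 1) * h3

/-- **`S_B = ρ(S_A)` in coordinates**: the part of the disc beyond the chord `x + √3 y = 1`.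
[folklore] -/
theorem mem_segB_iff (z : Fin 2 → ℝ) :
    z ∈ ρ '' (piRep.slabRestrict (-2) (-1/2)).domain ↔
      z 0 ^ 2 + z 1 ^ 2 ≤ 1 ∧ 1 < z 0 + Real.sqrt 3 * z 1 := by
  constructor
  · rintro ⟨x, hx, rfl⟩
    rw [mem_segA_domain] at hx
    refine ⟨by rw [normSq_rotNeg hρ]; exact hx.1, ?_⟩
    rw [form_rotNeg hρ]
    linarith [hx.2.2]
  · rintro ⟨hd, hf⟩
    refine ⟨σ z, ?_, rotNeg_rotPos hρ hσ z⟩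
    rw [mem_segA_domain, normSq_rotPos hσ]
    have h2 := form_le_two hd
    refine ⟨hd, ?_, ?_⟩
    · rw [rotPos_apply_zero hσ]; nlinarith
    · rw [rotPos_apply_zero hσ]; nlinarith

/-- **`S_C = σ(S_A)` in coordinates**: the part of the disc beyond the chord `x − √3 y = 1`.
[folklore] -/
theorem mem_segC_iff (z : Fin 2 → ℝ) :
    z ∈ σ '' (piRep.slabRestrict (-2) (-1/2)).domain ↔
      z 0 ^ 2 + z 1 ^ 2 ≤ 1 ∧ 1 < z 0 - Real.sqrt 3 * z 1 := by
  constructor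
  · rintro ⟨x, hx, rfl⟩
    rw [mem_segA_domain] at hx
    refine ⟨by rw [normSq_rotPos hσ]; exact hx.1, ?_⟩
    rw [form_rotPos hσ]
    linarith [hx.2.2]
  · rintro ⟨hd, hf⟩
    refine ⟨ρ z, ?_, rotPos_rotNeg hρ hσ z⟩
    rw [mem_segA_domain, normSq_rotNeg hρ]
    have h2 := form'_le_two hd
    refine ⟨hd, ?_, ?_⟩
    · rw [rotNeg_apply_zero hρ]; nlinarith
    · rw [rotNeg_apply_zero hρ]; nlinarith

/-- `S_B` lies in the disc. [folklore] -/
theorem segB_subset_piDisc : ρ '' (piRep.slabRestrict (-2) (-1/2)).domain ⊆ piDisc := fun z hz => by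
  rw [mem_piDisc]; exact ((mem_segB_iff hρ hσ z).1 hz).1

/-- `S_C` lies in the disc. [folklore] -/
theorem segC_subset_piDisc : σ '' (piRep.slabRestrict (-2) (-1/2)).domain ⊆ piDisc := fun z hz => by
  rw [mem_piDisc]; exact ((mem_segC_iff hρ hσ z).1 hz).1

omit hσ in
/-- `S_B` is `ℚ`-semialgebraic (image of a semialgebraic set under a semialgebraic map).
[folklore] -/
theorem isSemialgebraic_segB :
    Literature.ModelTheory.ExponentialFields.IsSemialgebraic ℚ (ρ '' (piRep.slabRestrict (-2) (-1/2)).domain) :=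
  IsSemialgebraicMapOn.isSemialgebraic_image_holds
    (isSemialgebraicMapOn_rotNeg hρ (piRep.slabRestrict (-2) (-1/2)).isSemialgebraic_domain)
    subset_rfl (piRep.slabRestrict (-2) (-1/2)).isSemialgebraic_domain

omit hρ in
/-- `S_C` is `ℚ`-semialgebraic. [folklore] -/
theorem isSemialgebraic_segC :
    Literature.ModelTheory.ExponentialFields.IsSemialgebraic ℚ (σ '' (piRep.slabRestrict (-2) (-1/2)).domain) :=
  IsSemialgebraicMapOn.isSemialgebraic_image_holds
    (isSemialgebraicMapOn_rotPos hσ (piRep.slabRestrict (-2) (-1/2)).isSemialgebraic_domain)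
    subset_rfl (piRep.slabRestrict (-2) (-1/2)).isSemialgebraic_domain

/-- **`[S_A] − [S_B]` is one change of variables** (the rotation `ρ`, determinant `1`).
[folklore] -/
theorem of_segA_sub_of_segB_mem :
    of (piRep.slabRestrict (-2) (-1/2)) -
      of (piRep.restrict (ρ '' (piRep.slabRestrict (-2) (-1/2)).domain) (isSemialgebraic_segB hρ)
        (segB_subset_piDisc hρ hσ)) ∈ changeOfVariablesRel := by
  refine ⟨2, piRep.slabRestrict (-2) (-1/2), piRep.restrict _ (isSemialgebraic_segB hρ)
      (segB_subset_piDisc hρ hσ), ρ, fun _ => ρ,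
    isSemialgebraicMapOn_rotNeg hρ (piRep.slabRestrict (-2) (-1/2)).isSemialgebraic_domain,
    fun x _ => ρ.hasFDerivAt.hasFDerivWithinAt, ?_, rfl, ?_, rfl⟩
  · intro x _ y _ h
    have := congrArg σ h
    rwa [rotPos_rotNeg hρ hσ, rotPos_rotNeg hρ hσ] at this
  · intro x _
    show (1 : ℝ) = 1 * |ρ.det|
    rw [det_rotNeg hρ]; simp

/-- **`[S_A] − [S_C]` is one change of variables** (the rotation `σ`, determinant `1`).
[folklore] -/
theorem of_segA_sub_of_segC_mem :
    of (piRep.slabRestrict (-2) (-1/2)) -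
      of (piRep.restrict (σ '' (piRep.slabRestrict (-2) (-1/2)).domain) (isSemialgebraic_segC hσ)
        (segC_subset_piDisc hρ hσ)) ∈ changeOfVariablesRel := by
  refine ⟨2, piRep.slabRestrict (-2) (-1/2), piRep.restrict _ (isSemialgebraic_segC hσ)
      (segC_subset_piDisc hρ hσ), σ, fun _ => σ,
    isSemialgebraicMapOn_rotPos hσ (piRep.slabRestrict (-2) (-1/2)).isSemialgebraic_domain,
    fun x _ => σ.hasFDerivAt.hasFDerivWithinAt, ?_, rfl, ?_, rfl⟩
  · intro x _ y _ h
    have := congrArg ρ h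
    rwa [rotNeg_rotPos hρ hσ, rotNeg_rotPos hρ hσ] at this
  · intro x _
    show (1 : ℝ) = 1 * |σ.det|
    rw [det_rotPos hσ]; simp

end BothRot

/-- **REGISTERED STUB (segment rotations).** The slab segment `S_A = D ∩ {x < -1/2}` is
KZ-equivalent, by one rotation each (rule (2), real-algebraic entries `-1/2, ±√3/2`, determinant `1`),
to the segments of the disc beyond the chords `x + √3 y = 1` and `x − √3 y = 1`. [folklore] -/
theorem stub_segmentRotations :
    ∃ SB SC : IntegralRep 2,
      SB.domain = {z : Fin 2 → ℝ | z 0 ^ 2 + z 1 ^ 2 ≤ 1 ∧ 1 < z 0 + Real.sqrt 3 * z 1} ∧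
      SC.domain = {z : Fin 2 → ℝ | z 0 ^ 2 + z 1 ^ 2 ≤ 1 ∧ 1 < z 0 - Real.sqrt 3 * z 1} ∧
      (SB.integrand = fun _ => 1) ∧ (SC.integrand = fun _ => 1) ∧
      of (piRep.slabRestrict (-2) (-1/2)) - of SB ∈ relations ∧
      of (piRep.slabRestrict (-2) (-1/2)) - of SC ∈ relations := by
  set ρ : (Fin 2 → ℝ) →L[ℝ] (Fin 2 → ℝ) := LinearMap.toContinuousLinearMap
    (Matrix.toLin' (!![-(1/2 : ℝ), Real.sqrt 3 / 2; -(Real.sqrt 3 / 2), -(1/2)] : Matrix (Fin 2) (Fin 2) ℝ))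
    with hρ
  set σ : (Fin 2 → ℝ) →L[ℝ] (Fin 2 → ℝ) := LinearMap.toContinuousLinearMap
    (Matrix.toLin' (!![-(1/2 : ℝ), -(Real.sqrt 3 / 2); Real.sqrt 3 / 2, -(1/2)] : Matrix (Fin 2) (Fin 2) ℝ))
    with hσ
  exact ⟨piRep.restrict _ (isSemialgebraic_segB hρ) (segB_subset_piDisc hρ hσ),
    piRep.restrict _ (isSemialgebraic_segC hσ) (segC_subset_piDisc hρ hσ),
    Set.ext (mem_segB_iff hρ hσ), Set.ext (mem_segC_iff hρ hσ), rfl, rfl,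
    changeOfVariablesRel_subset_relations (of_segA_sub_of_segB_mem hρ hσ),
    changeOfVariablesRel_subset_relations (of_segA_sub_of_segC_mem hρ hσ)⟩

end Summit.KontsevichZagierPeriods.KontsevichZagierPeriods.BetaCancellationLine
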